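import Summits.AnomalousDissipation.AnomalousDissipation.Cruxes.BurgersLayerKH.SketchIdeator2

/-!
# Line `pt-standing-mode-continuation` for crux `BurgersLayerKH` (stmt-AnomalousDissipation-3008) — skeleton v1

Planner `planner-cruxplan-stmt-AnomalousDissipation-3008-pt-standing-mode-con-0`, 2026-08-16. Line card:
`Cruxes/BurgersLayerKH/Lines/pt-standing-mode-continuation.md`; idea card
`Cruxes/BurgersLayerKH/Ideas/pt-standing-mode-continuation.md` (triage r1-1 / r1-2: pass, "merge-candidate with
`odd-evans-ivt` — same lever, different closing device"). Vocabulary (`erfU`, `erfU''`, `erfK`, `IsRayleighMode`,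
`IsStrainedMode`, `PersistenceQuant`) is imported from `Cruxes/BurgersLayerKH/SketchIdeator2.lean` so that the
persistence stub is LITERALLY the statement shared with the sibling lines (lever A).

Crux (FIXED; concluded BY NAME by `BurgersLayerKH_of`):
`Summit.AnomalousDissipation.AnomalousDissipation.Theses.MarginalStabilityChain.BurgersLayerKH` — `∃ Re₂ c₀ > 0,
∀ Re ≥ Re₂`, an eigenmode `(α > 0, σ, ψ ∈ C⁴, ψ ≢ 0, ψ → 0, |ω| ≤ Ce^{−y²/4})` of
`σω = −iαRe(Uω + U''ψ) + ω + yω' + ω'' − α²ω` with `re σ ≥ c₀·Re`.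

## The line in one paragraph

`U = ∫₀ʸ e^{−s²/2}` is ODD, so for a purely imaginary phase speed `c = i·cᵢ` the Rayleigh equation
`(U − c)(ψ'' − α²ψ) − U''ψ = 0` is the Schrödinger problem `ψ'' = (α² + V_{cᵢ})ψ`, `V_{cᵢ} = U''/(U − icᵢ)`, whose
potential is `J`-symmetric (`V(−y) = conj V(y)`), bounded by `K := −U''/U ≤ 1` UNIFORMLY in `cᵢ ≥ 0` (`U''(0) = 0`:
the neutral limit `cᵢ → 0⁺`, `V_0 = −K`, is regular — no critical layer is ever formed on the imaginary axis) and
Gaussian-tailed. Consequently the Evans function on the imaginary axis collapses to ONE REAL NUMBER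
`G(α, cᵢ) := re(conj ψ₊(0)·ψ₊'(0))` built from the solution `ψ₊` decaying at `+∞` (the mirror image
`conj ψ₊(−·)` is the solution decaying at `−∞`; their Wronskian at `0` is `2G`). At `cᵢ = 0` the problem is the
self-adjoint well `−∂² − K`, which has an even positive ground state `φ_s` at `E₀ = −α_s²` (`α_s = 0.733`,
Beronov–Kida's inviscid cut-off; in-tree variational tool), and the Wronskian identity
`φ_s(0)ψ₊'(0) = (α_s² − α²)∫₀^∞ φ_s ψ₊` makes `α ↦ G(α, 0)` change sign TRANSVERSALLY at `α_s` (`> 0` below, `< 0`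
above). A transversal real zero of a jointly continuous real function persists: for every small `cᵢ > 0` there is
`α(cᵢ)` near `α_s` with `G(α(cᵢ), cᵢ) = 0` (intermediate value theorem in `α`) — the STANDING unstable Rayleigh mode
`(α(cᵢ), icᵢ)` continued out of the neutral mode, with reality of the eigenvalue automatic (this is the
"PT-unbroken continuation" of the idea card, with norm-resolvent continuity + Riesz projection + `J`-uniqueness
replaced by the sign of one real continuous function; it needs neither holomorphy nor the `cᵢ → ∞` asymptotics of
`odd-evans-ivt`). The strain and viscous terms are then switched on by the shared persistence lever
(`PersistenceQuant`, lever A of cards gaussian-splitting-persistence / dissipative-compact-persistence): the Rayleigh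
eigenvalue `λ₀ = α cᵢ > 0` of the skew + compact vorticity operator on `L²(e^{y²/2})` persists under the
`(1/Re)`·(Ornstein–Uhlenbeck) perturbation, giving `re σ ≥ (α cᵢ/2)·Re` for `Re ≥ Re₂`.

## Registered stubs (the only `sorry`s) and the composition

* `stub_neutralMode`      — S: the neutral mode (ground state of `−∂² − K`).                       size M
* `stub_endpointSigns`    — N: S-data ⇒ two-sided sign of `G(α, 0)` across `α_s`.                 size M
* `stub_jostFamily`       — J: decaying solutions of the PT family with data at `y = 0` jointly
                             continuous in `(α, cᵢ)` on rectangles INCLUDING `cᵢ = 0`.              size L  (hardest proper stub)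
* `stub_evansCriterion`   — R: `cᵢ > 0`, decaying solution with `G = 0` ⇒ a Rayleigh mode at `icᵢ`. size M
* `stub_persistence`      — P: `PersistenceQuant` (lever A, shared).                               size XL (hardest overall)
* `BurgersLayerKH_of`     — S → N → J → R → P → crux; sign persistence + IVT + unpacking; NO sorry.

## Disproof.lean (cdisprove v4b, rc 0) honoured

* `burgersLayerKH_false_without_coupling` (any proof must use the inflection-point coupling `U''ψ`): the coupling IS
  the potential here — `V_{cᵢ} = U''/(U − icᵢ)` in J/R and `K = −U''/U` in S/N; nothing survives with `U'' := 0`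
  (`−∂²` has no bound state: S fails, as it must).
* `burgersLayerKH_false_forall_Re` (the threshold `Re₂` is load-bearing): `Re₂` is produced by P at `ρ = αcᵢ/2`.
* `burgersLayerKH_false_real_mode` (no real eigenpair): the modes built here have REAL `σ` (standing) but genuinely
  complex, `J`-symmetric `ψ` (`ψ(−y) = conj ψ(y)` up to a phase) — exactly the structure §3c leaves open.
* tightness `re σ + α² ≤ √(π/2)|Re|`: `c₀ = α(cᵢ)cᵢ/2` with `α ≈ 0.73`, `cᵢ` small — far below the ceiling.
* No `Theorems/BurgersLayerKH/Negative/` lemma has landed (nothing to import); `ledger negatives` (5 items) has no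
  spectral statement.
-/

set_option linter.dupNamespace false

noncomputable section

open Filter Topology Set

namespace Summit.AnomalousDissipation.AnomalousDissipation.Cruxes.BurgersLayerKH.PtStandingModeContinuation

open Summit.AnomalousDissipation.AnomalousDissipation.Theses.MarginalStabilityChain
open Literature.Analysis.ODE

/-! ## §0 Vocabulary of the line (definitions only) -/

/-- **The PT-symmetric Rayleigh potential on the imaginary `c`-axis.** For `c ≠ 0`:
`V_c(y) = U''(y)/(U(y) − i c)` (denominator never vanishes); for `c = 0` the regular limit `V_0 = −K = U''/U`
with the removable singularity at `y = 0` filled in (`erfK 0 = 1`). Properties the line uses (all elementary,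
proved by the stubs' provers, not here): `V_c(−y) = conj (V_c y)` (`U`, `U''` odd); `‖V_c y‖ ≤ erfK y ≤ 1`;
`V_c → V_0` in `L¹(ℝ)` and locally uniformly away from `y = 0` as `c → 0⁺` (`∫|V_c − V_0| = O(c log(1/c))`), but
NOT uniformly (`V_c(0) = 0`, `V_0(0) = −1`). [folklore] -/
def ptPot (c y : ℝ) : ℂ :=
  if c = 0 then -((erfK y : ℝ) : ℂ) else ((erfU'' y : ℝ) : ℂ) / (((erfU y : ℝ) : ℂ) - (c : ℂ) * Complex.I)

/-- The coefficient of the mode equation `ψ'' = (α² + V_c) ψ` (Rayleigh's equation at `c ↦ i c` divided by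
`U − i c`). [folklore] -/
def ptQ (α c : ℝ) (y : ℝ) : ℂ := (α : ℂ) ^ 2 + ptPot c y

/-- **The real Evans datum** `G = re(conj ψ(0) · ψ'(0))` of a solution pair `(ψ, ψ')`. For the solution decaying
at `+∞` of a `J`-symmetric equation, `2G` is its Wronskian at `0` with its mirror image `conj ψ(−·)` (the solution
decaying at `−∞`), so `G = 0` iff the two decaying solutions match: an eigenvalue. `G` is real and scales by
`|λ|²` under `ψ ↦ λψ`, so its SIGN is a well-defined function of `(α, c)`. [folklore] -/
def evansG (ψ ψ' : ℝ → ℂ) : ℝ := ((starRingEnd ℂ) (ψ 0) * ψ' 0).re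

/-- **S — the neutral mode.** The Schrödinger operator `−∂² − K`, `K = −U''/U = y e^{−y²/2}/U(y) ∈ (0, 1]`, has a
bound state: `αs > 0` and a positive, even, classical solution `φs` of `φ'' = (αs² − K) φ` on `ℝ` tending to `0`
at `+∞` (hence at `±∞`, exponentially: the ground state, `E₀ = −αs²`; numerically `αs = 0.73299`,
Beronov–Kida's inviscid cut-off `α_cr = 0.733`). This is the STANDING NEUTRAL MODE `(α_s, c = 0, ψ = U·… )` of the
erf layer in Schrödinger form. [folklore] -/
def NeutralMode : Prop :=
  ∃ αs : ℝ, 0 < αs ∧ ∃ φs : ℝ → ℝ, IsSchrodingerSol (fun y => αs ^ 2 - erfK y) φs ∧ (∀ y, 0 < φs y) ∧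
    (∀ y, φs (-y) = φs y) ∧ Tendsto φs atTop (𝓝 0)

/-- **Two-sided endpoint signs at `c = 0` near a neutral wavenumber `αs`**: there is `η ∈ (0, αs)` such that for
every `α ∈ (αs − η, αs + η)` and every solution `ψ` of the `c = 0` equation `ψ'' = (α² − K)ψ` (complex-valued,
stated with the coefficient `ptQ α 0` literally) that decays at `+∞` and is not identically zero,
`G = re(conj ψ(0) ψ'(0))` is `> 0` if `α < αs` and `< 0` if `α > αs`. [folklore] -/
def EndpointSigns (αs : ℝ) : Prop :=
  ∃ η : ℝ, 0 < η ∧ η < αs ∧ ∀ α : ℝ, αs - η < α → α < αs + η → ∀ ψ ψ' : ℝ → ℂ,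
    IsSol2 (ptQ α 0) ψ ψ' univ → Tendsto ψ atTop (𝓝 0) → (∃ y, ψ y ≠ 0) →
      (α < αs → 0 < evansG ψ ψ') ∧ (αs < α → evansG ψ ψ' < 0)

/-- **N — endpoint signs from the neutral mode** (Weyl-function monotonicity at a ground state): any neutral-mode
datum `(αs, φs)` as in `NeutralMode` yields `EndpointSigns αs`. [folklore] -/
def EndpointSignsOfNeutral : Prop :=
  ∀ (αs : ℝ) (φs : ℝ → ℝ), 0 < αs → IsSchrodingerSol (fun y => αs ^ 2 - erfK y) φs → (∀ y, 0 < φs y) →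
    (∀ y, φs (-y) = φs y) → Tendsto φs atTop (𝓝 0) → EndpointSigns αs

/-- **J — the continuous family of decaying solutions (Jost family) of the PT problem, through the neutral
limit.** On every rectangle `α ∈ [a₁, a₂] ⊂ (0, ∞)`, `c ∈ [0, c₁]` there are solution pairs
`(Ψ α c, Ψ' α c)` of `ψ'' = (α² + V_c)ψ` on `ℝ`, each decaying at `+∞` and not identically zero, whose data at
`y = 0` depend CONTINUOUSLY on `(α, c)` — jointly, and up to and including `c = 0`. [folklore] -/
def JostFamily : Prop :=
  ∀ a₁ a₂ c₁ : ℝ, 0 < a₁ → a₁ ≤ a₂ → 0 < c₁ → ∃ Ψ Ψ' : ℝ → ℝ → ℝ → ℂ,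
    (∀ α ∈ Icc a₁ a₂, ∀ c ∈ Icc (0 : ℝ) c₁, IsSol2 (ptQ α c) (Ψ α c) (Ψ' α c) univ ∧
      Tendsto (Ψ α c) atTop (𝓝 0) ∧ ∃ y, Ψ α c y ≠ 0) ∧
    ContinuousOn (fun p : ℝ × ℝ => (Ψ p.1 p.2 0, Ψ' p.1 p.2 0)) (Icc a₁ a₂ ×ˢ Icc (0 : ℝ) c₁)

/-- **R — the real Evans criterion** (mirror-conjugate gluing): for `α > 0`, `c > 0`, a solution of
`ψ'' = (α² + U''/(U − ic))ψ` on `ℝ` that decays at `+∞`, is not identically zero and has `re(conj ψ(0)ψ'(0)) = 0`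
yields an unstable Rayleigh mode of the erf layer with the purely imaginary phase speed `c·I` (a STANDING mode:
`σ = αRe·c` real at `Re = ∞`). [folklore] -/
def EvansCriterion : Prop :=
  ∀ α c : ℝ, 0 < α → 0 < c → ∀ ψ ψ' : ℝ → ℂ, IsSol2 (ptQ α c) ψ ψ' univ → Tendsto ψ atTop (𝓝 0) →
    (∃ y, ψ y ≠ 0) → evansG ψ ψ' = 0 → ∃ φ : ℝ → ℂ, IsRayleighMode α ((c : ℂ) * Complex.I) φ

/-! ## §1 Registered stubs (statements = the named `Prop`s of §0 and `PersistenceQuant`, verbatim) -/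

/-- **Stub S (`NeutralMode`; size M).** WHY PLAUSIBLE: a one-dimensional well always binds. Proof plan: apply
`Literature.Analysis.ODE.exists_boundState_of_rayleigh` (PROVED; Hartman Ch. XI §6) with `W := −erfK`
(continuous — the micro-lemma `erfK` continuous at `0`, `erfK y = 1 − y²/3 + O(y⁴)`, i.e. `U(y)/y → 1`; bounded,
`|W| ≤ 1` since `y e^{−y²/2} ≤ U(y)` for `y ≥ 0`, derivative form `y² e^{−y²/2} ≥ 0`), test function
`ψ = e^{−y²/4}` (`∫ψ'² = √(2π)/4 ≈ 0.627`, `∫Kψ² = ∫(y/U)e^{−y²} ≥ ∫e^{−y²} = √π ≈ 1.772` because `|U(y)| ≤ |y|`,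
`∫ψ² = √(2π)`; quotient `≤ −0.45 < E' := −0.4`; `W − E' ≥ c := 0.2` for `|y| ≥ 2.2`; a cruder wide Gaussian
`e^{−y²/16}` with `∫Kψ² ≥ 2e^{−1}·…` on `[−1,1]` avoids all numerics), giving `E ≤ E'`, `u > 0`,
`u'' = (W − E)u`, `u, u' ∈ L²`; set `αs := √(−E)`. Evenness: `u(−·)` is a positive `L²` solution of the same (even)
equation, the Wronskian of two `L²` solution pairs is an integrable constant hence `0`, so `u(−·) = λu`, and
`λ = 1` at `y = 0`. Decay at `+∞`: `u²` has integrable derivative `2uu'` and is integrable. Leans on: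
`exists_boundState_of_rayleigh`, `IsSchrodingerSol.comp_neg`, `IsSol2.wronskian_eq` /
`SchrodingerSturm`, `intervalIntegral` Gaussian integrals (`integral_gaussian`), `erfU`/`erfK` micro-lemmas
(`erfU` odd: `burgersLayerProfile_neg` pattern; `hasDerivAt` of `erfU` = Gaussian by FTC). [folklore] -/
theorem stub_neutralMode :
    ∃ αs : ℝ, 0 < αs ∧ ∃ φs : ℝ → ℝ, IsSchrodingerSol (fun y => αs ^ 2 - erfK y) φs ∧ (∀ y, 0 < φs y) ∧
      (∀ y, φs (-y) = φs y) ∧ Tendsto φs atTop (𝓝 0) := by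
  sorry

/-- **Stub N (`EndpointSignsOfNeutral`; size M).** WHY PLAUSIBLE (and checked numerically: `R(α) := ψ₊'(0)/ψ₊(0)`
at `c = 0` is `0.070, 0.027, −0.014, −0.055` at `α = 0.70, 0.72, 0.74, 0.76`, three independent shootings,
TRIAGE-r1-1/2): (1) `ptQ α 0 y = α² − erfK y` is real, so a complex solution decaying at `+∞` is `λ·u` with `u`
the real recessive solution (`re ψ`, `im ψ` both decay; decaying solutions are recessive and the recessive solutions
form a line: `IsSol2.solEnergy_nonpos_of_bounded`, `wronskian_eq_zero_of_recessive` in `RecessiveSolution.lean`,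
with `re (ptQ α 0) ≥ α²/2` on a tail; then `IsSol2.exists_eq_smul_of_wronskian_eq_zero`), and
`G = |λ|²·u(0)u'(0)`. (2) The positive even `φs` is the ground
state; the two-potential Wronskian identity (`hasDerivAt_wronskian₂`, `wronskian_eq_neg_integral_Ioi`,
`tendsto_wronskian_zero_of_decay`) with `φs'(0) = 0` gives `φs(0)·u'(0) = (αs² − α²)·∫₀^∞ φs u`. (3) For `α` in a
small window around `αs`, `u > 0` on `[0, ∞)`: on `[Y, ∞)` where `erfK < α²/2` a decaying solution has no zero
(energy/convexity: `decay_of_deriv_nonpos_tail`, `shooting_decay_right` pattern; for `α > αs` even globally: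
`−α²` lies below the ground energy, Sturm), and on `[0, Y]` the normalised recessive solutions converge uniformly
to `φs > 0` as `α → αs` (continuous dependence `IsSol2.dist_le`; the coefficient change is `|α² − αs²|`,
uniform; the recessive direction at `Y` is the uniform limit of the directions of solutions vanishing at
`T → ∞`). Hence `sign u'(0) = sign(αs − α)` and `u(0) > 0`: `G > 0` below `αs`, `G < 0` above; choose
`η < αs`. Leans on: the tree files `SchrodingerODE`, `SchrodingerSturm`,
`HalfLineShooting`, `ComplexSecondOrder`, `WronskianMatching`, `RecessiveSolution` (all PROVED). [folklore] -/
theorem stub_endpointSigns :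
    ∀ (αs : ℝ) (φs : ℝ → ℝ), 0 < αs → IsSchrodingerSol (fun y => αs ^ 2 - erfK y) φs → (∀ y, 0 < φs y) →
      (∀ y, φs (-y) = φs y) → Tendsto φs atTop (𝓝 0) → EndpointSigns αs := by
  sorry

/-- **Stub J (`JostFamily`; size L — the hardest stub PROPER to this line).** WHY PLAUSIBLE: for each `(α, c)`,
`c ≥ 0`, `α > 0`, the coefficient `ptQ α c` is continuous on `ℝ` (for `c > 0` the denominator `U − ic` never
vanishes; for `c = 0` by the `erfK` micro-lemma) and `ptQ α c − α²` is bounded by `erfK ≤ 1` with Gaussian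
tails UNIFORMLY in `c ≥ 0`; so the Jost solution `ψ₊(y; α, c) = e^{−αy}(1 + o(1))` exists on `[Y₀, ∞)` by the
Volterra/Green iteration of `JostGreen`/`JostDecay` (`jostY`, `hasDerivAt_jostY`, `norm_jostY_le`,
`exists_jostY_ne_zero`; smallness `jostKconst·‖w‖ < 1` holds for `Y₀` large uniformly on the rectangle because
the tail `sup_{y ≥ Y₀} erfK` is Gaussian-small; parameter dependence `contDiffAt_jostY_param` in `α`, and in `c`
for `c > 0`), and is continued to `y = 0` by global existence/uniqueness for the linear equation
(`exists_isSol2_Ioi`, `IsSol2.eqOn_Ioi`; take `Ψ α c :=` the global solution with the Jost data at `Y₀ + 1`).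
CONTINUITY of the data at `0`: on `[Y₀, ∞)` the family is continuous in `(α, c)` including `c = 0`
(`sup_{y ≥ Y₀}|V_c − V_0| ≤ c·erfK(Y₀)/U(Y₀) → 0`); on `[0, Y₀ + 1]` use Grönwall in the `L¹`-in-coefficient
form (`‖X_c(0) − X_0(0)‖ ≤ (‖X_c(Y₀+1) − X_0(Y₀+1)‖ + ‖X_0‖_∞ ∫₀^{Y₀+1}|ptQ α c − ptQ α' 0|)·e^{(2+a₂²)(Y₀+1)}`,
a variant of `IsSol2.dist_le`, which is stated with a sup bound `η` — the one genuinely new M-sized lemma), fed by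
`∫₀^{Y}|V_c − V_0| ≤ ∫₀^{Y} c·erfK/√(U² + c²) ≤ c·e^{1/2}·arsinh(1/c) + c·Y/U(1) → 0` (`U(y) ≥ y e^{−1/2}` on
`[0,1]`) and `|α² − α'²|·Y`. This is the card's "regular neutral limit" (`‖V_c − V_0‖₂² ≈ πc`, `U''(0) = 0`) in
ODE clothing; numerically the leading data are continuous to plotting accuracy (j004783, j004866, TRIAGE
`evans_check.py`). Leans on: `JostGreen`, `JostDecay`, `ComplexSecondOrder` (`exists_isSol2_Ioi`, `IsSol2.dist_le`,
`IsSol2.mono`), `RecessiveSolution` (`exists_recessive`, `wronskian_eq_zero_of_recessive`, `recessive_decay`: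
with `re (ptQ α c) ≥ α² − erfK ≥ a₁²/2` on a tail UNIFORMLY in `c ≥ 0`, the decaying solutions are exactly the
recessive line, for `c = 0` and `c > 0` alike), `LinearSecondOrder` (`exists_solution_Ioi`), Mathlib
`gronwallBound`. REMARK (slack for the lead): the composition below uses only SEPARATE continuity — in `c` on
`[0, c₁]` at the two `α`-endpoints and in `α` on `[a₁, a₂]` at each fixed `c ∈ (0, c₁]` — so J may be weakened
to that form without changing `BurgersLayerKH_of` beyond its two `ContinuousOn.comp` lines. [folklore] -/
theorem stub_jostFamily :
    ∀ a₁ a₂ c₁ : ℝ, 0 < a₁ → a₁ ≤ a₂ → 0 < c₁ → ∃ Ψ Ψ' : ℝ → ℝ → ℝ → ℂ,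
      (∀ α ∈ Icc a₁ a₂, ∀ c ∈ Icc (0 : ℝ) c₁, IsSol2 (ptQ α c) (Ψ α c) (Ψ' α c) univ ∧
        Tendsto (Ψ α c) atTop (𝓝 0) ∧ ∃ y, Ψ α c y ≠ 0) ∧
      ContinuousOn (fun p : ℝ × ℝ => (Ψ p.1 p.2 0, Ψ' p.1 p.2 0)) (Icc a₁ a₂ ×ˢ Icc (0 : ℝ) c₁) := by
  sorry

/-- **Stub R (`EvansCriterion`; size M).** WHY PLAUSIBLE: for `c > 0`, `ptQ α c y = α² + U''(y)/(U(y) − ic)`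
(`if_neg`), continuous, with the MIRROR IDENTITY `ptQ α c (−y) = conj (ptQ α c y)` (`U`, `U''` odd — for `erfU` by
`intervalIntegral.integral_comp_neg` and evenness of the Gaussian; for `erfU''` by `ring`). Hence
`ψ₋(y) := conj ψ(−y)`, `ψ₋'(y) := −conj ψ'(−y)` is a solution pair decaying at `−∞` (`HasDerivAt.comp_neg` +
`HasDerivAt.star`/`conj`), and `W[ψ₋, ψ](0) = conj ψ(0)·ψ'(0) + conj ψ'(0)·ψ(0) = 2·evansG ψ ψ' = 0`. Two solution
pairs with vanishing Wronskian are proportional (`IsSol2.exists_eq_smul_of_wronskian_eq_zero`; `ψ₋ ≢ 0`):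
`ψ = μ ψ₋` with `|μ| = 1`, so `ψ` itself decays at `−∞` as well (no gluing discontinuity: `ψ` is already a global
solution). Then `φ := ψ` satisfies `(U − ic)(φ'' − α²φ) − U''φ = 0` pointwise (multiply back; `U − ic ≠ 0`),
`φ ∈ C²` (`IsSol2.contDiffOn` / the equation with continuous coefficient), `φ ≢ 0`, `φ → 0` at `±∞`,
`im (c·I) = c > 0`: `IsRayleighMode α (c·I) φ`. (Up to the phase `μ^{1/2}` the mode is `J`-symmetric,
`φ(−y) = conj φ(y)`: real part even, imaginary part odd — the standing-mode structure of Beronov–Kida 1995 and the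
complement of Disproof §3c.) Leans on: `ComplexSecondOrder` (`IsSol2.comp_neg`, `wronskian`,
`exists_eq_smul_of_wronskian_eq_zero`, `eqOn_Ioi`, `contDiffOn`), `Mathlib.Analysis.Calculus.Deriv.Star`,
`erfU` oddness. [folklore] -/
theorem stub_evansCriterion :
    ∀ α c : ℝ, 0 < α → 0 < c → ∀ ψ ψ' : ℝ → ℂ, IsSol2 (ptQ α c) ψ ψ' univ → Tendsto ψ atTop (𝓝 0) →
      (∃ y, ψ y ≠ 0) → evansG ψ ψ' = 0 → ∃ φ : ℝ → ℂ, IsRayleighMode α ((c : ℂ) * Complex.I) φ := by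
  sorry

/-- **Stub P (`PersistenceQuant` of `SketchIdeator2.lean`, lever A — shared verbatim with the sibling lines
gaussian-splitting-persistence ≈ dissipative-compact-persistence ≈ gaussian-dissipative-birman-schwinger; size XL,
the hardest stub of every line on this crux).** For every Rayleigh mode `(α, c, φ)` and every `ρ > 0` there is
`Re₂ > 0` such that for `Re ≥ Re₂` the strained viscous operator at the SAME `α` has a mode `(σ, ψ)` in the crux's
class (`IsStrainedMode` = the crux body minus the growth clause) with `‖σ/Re + iαc‖ < ρ`. WHY PLAUSIBLE: in
vorticity form on `X = L²(e^{y²/2} dy)` the operator is `Re·(M + K) + A`, `M = −iαU·` bounded skew-adjoint,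
`Kω = −iαU''·(G_α ∗ ω)` Hilbert–Schmidt (`U'' ∈ X`), `A = ∂² + y∂ + 1 − α² ≤ −α²` self-adjoint
(Ornstein–Uhlenbeck ≅ Hermite) with compact resolvent; `λ₀ = −iαc` (`re λ₀ = α·im c > 0`) is an isolated
eigenvalue of `M + K` (the mode's vorticity `−U''φ/(U − c)` lies in `X` since `φ` is bounded and
`|U − c| ≥ im c`); `‖(M + εA − z)⁻¹‖ ≤ 1/re z` uniformly in `ε = 1/Re ≥ 0` (Lumer–Phillips — the inequality form
of Disproof's `re_le_of_noCoupling` engine, `WeightedDissipativity` in SketchIdeator2), `(M + εA − z)⁻¹K →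
(M − z)⁻¹K` in NORM (strong × compact), so the Riesz projection / finite-rank determinant on a small circle
around `λ₀` inside `re z > 0` persists (in tree: `spectrum_add_compact_isolated_eigenvalues_halfPlane`,
`isUnit_one_sub_or_exists_fixed_of_isCompactOperator`, `exists_fixed_iff_det_eq_zero`,
`Complex.eventually_exists_zero_mem_ball_of_tendstoUniformlyOn`); an eigenvector `ω ∈ D(A)` has
`e^{y²/4}ω ∈ H¹ ⊂ L^∞` (the crux's Gaussian class for free) and `ψ = G_α ∗ ω ∈ C⁴`, `ψ → 0` by bootstrapping the
ODE. Numerically `σ(Re, α) = αcᵢ·Re − 0.45… + O(1/Re)`, `σ` real, four independent codes (Disproof §4, j004866,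
j004783, j004789). Triage sharpening: plan it at FIXED `α` as a finite-rank reduction `K = K_N + small` with a
real determinant on the `J`-real sector + IVT/Hurwitz — the A-line skeleton owns this interior; this line only
consumes the interface. [folklore] -/
theorem stub_persistence :
    ∀ (α : ℝ) (c : ℂ) (φ : ℝ → ℂ), IsRayleighMode α c φ → ∀ ρ : ℝ, 0 < ρ → ∃ Re₂ : ℝ, 0 < Re₂ ∧
      ∀ Re : ℝ, Re₂ ≤ Re → ∃ (σ : ℂ) (ψ : ℝ → ℂ), IsStrainedMode Re α σ ψ ∧
        ‖σ / (Re : ℂ) + Complex.I * (α : ℂ) * c‖ < ρ := by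
  sorry

/-! ## §2 Name-keyed aliases of the registered stubs

`Registered.stub_X : Prop` is the statement of `stub_X` under the stub's own short name, so that the native skeleton
audit (`#h21_check_skeleton`: hypotheses of the composing theorem are admissible iff they are registered obligations /
declared stubs BY NAME) reads the hypotheses of `BurgersLayerKH_of` as the five registered stubs (convention of
`Cruxes/HonestFixedRadiusSettling/Lines/far_field_surgery.lean`). -/
namespace Registered

/-- Statement of `stub_neutralMode` (= `NeutralMode`). [folklore] -/
abbrev stub_neutralMode : Prop := NeutralMode
/-- Statement of `stub_endpointSigns` (= `EndpointSignsOfNeutral`). [folklore] -/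
abbrev stub_endpointSigns : Prop := EndpointSignsOfNeutral
/-- Statement of `stub_jostFamily` (= `JostFamily`). [folklore] -/
abbrev stub_jostFamily : Prop := JostFamily
/-- Statement of `stub_evansCriterion` (= `EvansCriterion`). [folklore] -/
abbrev stub_evansCriterion : Prop := EvansCriterion
/-- Statement of `stub_persistence` (= `PersistenceQuant`). [folklore] -/
abbrev stub_persistence : Prop := PersistenceQuant

end Registered

/-- Consistency check: the registered stubs prove their name-keyed statements (the inline stub signatures ARE
the named `Prop`s, syntactically). -/
example : Registered.stub_neutralMode ∧ Registered.stub_endpointSigns ∧ Registered.stub_jostFamily ∧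
    Registered.stub_evansCriterion ∧ Registered.stub_persistence :=
  ⟨stub_neutralMode, stub_endpointSigns, stub_jostFamily, stub_evansCriterion, stub_persistence⟩

/-! ## §3 The composition (kernel-checked; no `sorry` of its own) -/

/-- **Sign persistence + intermediate value: the standing Rayleigh mode continued out of the neutral mode.**
From S, N, J, R alone (no persistence): there are `α > 0`, `c > 0` and an unstable Rayleigh mode of the erf layer
with purely imaginary phase speed `c·I`. Proof: N at the S-datum gives the window `η` and the signs; J on the
rectangle `[αs − η/2, αs + η/2] × [0, 1]` gives a continuous real function `G(α, c)` with `G(αs − η/2, 0) > 0 >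
G(αs + η/2, 0)`; by continuity both signs persist for `c ∈ [0, c⋆]`, `c⋆ > 0`; the intermediate value theorem in
`α` at `c = c⋆` gives a zero, and R turns it into the mode. [folklore] -/
theorem exists_standing_rayleighMode (hS : Registered.stub_neutralMode) (hN : Registered.stub_endpointSigns)
    (hJ : Registered.stub_jostFamily) (hR : Registered.stub_evansCriterion) :
    ∃ (α c : ℝ) (φ : ℝ → ℂ), 0 < α ∧ 0 < c ∧ IsRayleighMode α ((c : ℂ) * Complex.I) φ := by
  -- S and N: the neutral wavenumber and the two-sided signs at `c = 0`
  obtain ⟨αs, hαs, φs, hφs, hpos, heven, hdec⟩ := hS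
  obtain ⟨η, hη, hηαs, hsign⟩ := hN αs φs hαs hφs hpos heven hdec
  set a₁ : ℝ := αs - η / 2 with ha₁
  set a₂ : ℝ := αs + η / 2 with ha₂
  have ha₁pos : 0 < a₁ := by rw [ha₁]; linarith
  have ha₁₂ : a₁ ≤ a₂ := by rw [ha₁, ha₂]; linarith
  have ha₁win : αs - η < a₁ ∧ a₁ < αs + η ∧ a₁ < αs := ⟨by rw [ha₁]; linarith, by rw [ha₁]; linarith, by rw [ha₁]; linarith⟩
  have ha₂win : αs - η < a₂ ∧ a₂ < αs + η ∧ αs < a₂ := ⟨by rw [ha₂]; linarith, by rw [ha₂]; linarith, by rw [ha₂]; linarith⟩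
  -- J: the continuous family on the rectangle `[a₁, a₂] × [0, 1]`
  obtain ⟨Ψ, Ψ', hfam, hcont⟩ := hJ a₁ a₂ 1 ha₁pos ha₁₂ one_pos
  set R : Set (ℝ × ℝ) := Icc a₁ a₂ ×ˢ Icc (0 : ℝ) 1 with hRdef
  -- the real Evans function of the family and its continuity on the rectangle
  set G : ℝ × ℝ → ℝ := fun p => evansG (Ψ p.1 p.2) (Ψ' p.1 p.2) with hGdef
  have hGcont : ContinuousOn G R := by
    have h1 : ContinuousOn (fun p : ℝ × ℝ => (starRingEnd ℂ) (Ψ p.1 p.2 0) * Ψ' p.1 p.2 0) R :=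
      (Complex.continuous_conj.comp_continuousOn hcont.fst).mul hcont.snd
    exact Complex.continuous_re.comp_continuousOn h1
  -- signs at the two `α`-endpoints for `c = 0`
  have hmem₁ : a₁ ∈ Icc a₁ a₂ := ⟨le_rfl, ha₁₂⟩
  have hmem₂ : a₂ ∈ Icc a₁ a₂ := ⟨ha₁₂, le_rfl⟩
  have hc0 : (0 : ℝ) ∈ Icc (0 : ℝ) 1 := ⟨le_rfl, zero_le_one⟩
  have hG₁ : 0 < G (a₁, 0) := by
    obtain ⟨hsol, htend, hne⟩ := hfam a₁ hmem₁ 0 hc0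
    exact ((hsign a₁ ha₁win.1 ha₁win.2.1 (Ψ a₁ 0) (Ψ' a₁ 0) hsol htend hne).1 ha₁win.2.2)
  have hG₂ : G (a₂, 0) < 0 := by
    obtain ⟨hsol, htend, hne⟩ := hfam a₂ hmem₂ 0 hc0
    exact ((hsign a₂ ha₂win.1 ha₂win.2.1 (Ψ a₂ 0) (Ψ' a₂ 0) hsol htend hne).2 ha₂win.2.2)
  -- continuity in `c` at `c = 0` along the two vertical edges: the signs persist for small `c`
  have hedge : ∀ a ∈ Icc a₁ a₂, ContinuousOn (fun c : ℝ => G (a, c)) (Icc (0 : ℝ) 1) := by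
    intro a ha
    refine hGcont.comp (Continuous.continuousOn (by fun_prop)) ?_
    intro c hc
    exact mk_mem_prod ha hc
  have hev₁ : ∀ᶠ c in 𝓝[Icc (0 : ℝ) 1] 0, 0 < G (a₁, c) :=
    (hedge a₁ hmem₁ 0 hc0).eventually (eventually_gt_nhds hG₁)
  have hev₂ : ∀ᶠ c in 𝓝[Icc (0 : ℝ) 1] 0, G (a₂, c) < 0 :=
    (hedge a₂ hmem₂ 0 hc0).eventually (eventually_lt_nhds hG₂)
  obtain ⟨ε₁, hε₁, hε₁'⟩ := Metric.eventually_nhds_iff.1 (eventually_nhdsWithin_iff.1 hev₁)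
  obtain ⟨ε₂, hε₂, hε₂'⟩ := Metric.eventually_nhds_iff.1 (eventually_nhdsWithin_iff.1 hev₂)
  set cs : ℝ := min (min ε₁ ε₂ / 2) 1 with hcs
  have hcspos : 0 < cs := lt_min (by positivity) one_pos
  have hcs1 : cs ≤ 1 := min_le_right _ _
  have hcsε₁ : cs < ε₁ := by
    have h := min_le_left (min ε₁ ε₂ / 2) 1
    have h' := min_le_left ε₁ ε₂
    rw [hcs]; linarith
  have hcsε₂ : cs < ε₂ := by
    have h := min_le_left (min ε₁ ε₂ / 2) 1
    have h' := min_le_right ε₁ ε₂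
    rw [hcs]; linarith
  have hcsmem : cs ∈ Icc (0 : ℝ) 1 := ⟨hcspos.le, hcs1⟩
  have hdist : ∀ {ε : ℝ}, cs < ε → dist cs 0 < ε := fun h => by
    rwa [Real.dist_eq, sub_zero, abs_of_pos hcspos]
  have hG₁' : 0 < G (a₁, cs) := hε₁' (hdist hcsε₁) hcsmem
  have hG₂' : G (a₂, cs) < 0 := hε₂' (hdist hcsε₂) hcsmem
  -- intermediate value theorem in `α` on `[a₁, a₂]` at `c = cs`
  have hhor : ContinuousOn (fun a : ℝ => G (a, cs)) (Icc a₁ a₂) := by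
    refine hGcont.comp (Continuous.continuousOn (by fun_prop)) ?_
    intro a ha
    exact mk_mem_prod ha hcsmem
  have hzero : (0 : ℝ) ∈ (fun a : ℝ => G (a, cs)) '' Icc a₁ a₂ :=
    intermediate_value_Icc' ha₁₂ hhor ⟨hG₂'.le, hG₁'.le⟩
  obtain ⟨αz, hαz, hGz⟩ := hzero
  have hαzpos : 0 < αz := lt_of_lt_of_le ha₁pos hαz.1
  -- R: the zero is a standing Rayleigh mode
  obtain ⟨hsol, htend, hne⟩ := hfam αz hαz cs hcsmem
  obtain ⟨φ, hφ⟩ := hR αz cs hαzpos hcspos (Ψ αz cs) (Ψ' αz cs) hsol htend hne hGz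
  exact ⟨αz, cs, φ, hαzpos, hcspos, hφ⟩

/-- **Skeleton theorem.** The five registered stubs imply the crux `MarginalStabilityChain.BurgersLayerKH` BY
NAME: the standing Rayleigh mode `(α, c·I)` of `exists_standing_rayleighMode` (S, N, J, R) has growth
`re(−iα·(cI)) = α c > 0` at `Re = ∞`; P with `ρ := α c/2` gives `Re₂ > 0` and, for every `Re ≥ Re₂`, a mode of
the full strained viscous equation in the crux's class with `‖σ/Re − αc‖ < αc/2`, hence `re σ ≥ (αc/2)·Re`:
the crux with `c₀ := α c/2`. [folklore] -/
theorem BurgersLayerKH_of (hS : Registered.stub_neutralMode) (hN : Registered.stub_endpointSigns)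
    (hJ : Registered.stub_jostFamily) (hR : Registered.stub_evansCriterion)
    (hP : Registered.stub_persistence) : BurgersLayerKH := by
  obtain ⟨α, c, φ, hα, hc, hφ⟩ := exists_standing_rayleighMode hS hN hJ hR
  have hρ : 0 < α * c / 2 := by positivity
  obtain ⟨Re₂, hRe₂, hmodes⟩ := hP α ((c : ℂ) * Complex.I) φ hφ (α * c / 2) hρ
  refine ⟨Re₂, α * c / 2, hρ, fun Re hRe => ?_⟩
  have hRepos : 0 < Re := lt_of_lt_of_le hRe₂ hRe
  obtain ⟨σ, ψ, hmode, hnorm⟩ := hmodes Re hRe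
  -- the growth bound `(α c / 2)·Re ≤ re σ` from `‖σ/Re − αc‖ < αc/2`
  have hI : Complex.I * (α : ℂ) * ((c : ℂ) * Complex.I) = -(((α * c : ℝ)) : ℂ) := by
    have h2 : Complex.I * (α : ℂ) * ((c : ℂ) * Complex.I) = Complex.I ^ 2 * ((α : ℂ) * (c : ℂ)) := by ring
    rw [h2, Complex.I_sq]
    push_cast
    ring
  rw [hI] at hnorm
  have hre : (σ / (Re : ℂ) + -(((α * c : ℝ)) : ℂ)).re = σ.re / Re - α * c := by
    simp [Complex.add_re, Complex.neg_re, Complex.ofReal_re, Complex.div_ofReal_re, sub_eq_add_neg]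
  have habs := Complex.abs_re_le_norm (σ / (Re : ℂ) + -(((α * c : ℝ)) : ℂ))
  rw [hre] at habs
  have hlt : |σ.re / Re - α * c| < α * c / 2 := lt_of_le_of_lt habs hnorm
  have hlow : α * c / 2 < σ.re / Re := by
    have := (abs_lt.1 hlt).1
    linarith
  have hgrowth : α * c / 2 * Re ≤ σ.re := ((lt_div_iff₀ hRepos).1 hlow).le
  -- unpack the crux's class (`IsStrainedMode` is the crux body minus the growth clause, same `let`s)
  obtain ⟨hα', hψ4, hne, htop, hbot, hC, heq⟩ := hmode
  exact ⟨α, σ, ψ, hα', hgrowth, hψ4, hne, htop, hbot, hC, heq⟩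

/-- The crux from the stubs themselves (depends on their `sorry`s; it becomes a proof of the crux exactly when the
five stubs are closed). [folklore] -/
theorem BurgersLayerKH_of_stubs : BurgersLayerKH :=
  BurgersLayerKH_of stub_neutralMode stub_endpointSigns stub_jostFamily stub_evansCriterion stub_persistence

end Summit.AnomalousDissipation.AnomalousDissipation.Cruxes.BurgersLayerKH.PtStandingModeContinuation

end

#h21_check_skeleton "stmt-AnomalousDissipation-3008" Summit.AnomalousDissipation.AnomalousDissipation.Theses.MarginalStabilityChain.BurgersLayerKH stub_neutralMode stub_endpointSigns stub_jostFamily stub_evansCriterion stub_persistence
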